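import Literature.NumberTheory.GaloisRepresentations.TameInertiaProofs
import Literature.NumberTheory.GaloisRepresentations.ArtinConductorWildProofs
import Literature.NumberTheory.NumberFields.UnramifiedCubicResolventDiscriminant
import Literature.NumberTheory.NumberFields.UnramifiedIffDiscriminant
import Literature.NumberTheory.CubicFields.CubicResolventClosure
import HarnessLib

/-!
# Hasse: a cubic field of fundamental discriminant `d_K = d_k` has Galois closure unramified over `k = ℚ(√d_K)`

Topic `Literature/NumberTheory/CubicFields`.  Theorem-only file (no definition, no named fact,
D-0026): the converse of `UnramifiedCubicResolventDiscriminant.lean` (`d_F = d_K` for a cubic `F`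
inside a Galois sextic `L` unramified over its quadratic subfield `K`).  Here: if `L/ℚ` is a Galois
sextic, `K ⊆ L` quadratic, `F ⊆ L` cubic and **`d_F = d_K`**, then **`L/K` is unramified at every
maximal ideal of `𝓞 L`** (`isUnramifiedAt_of_discr_eq_discr`), hence `|d_L| = |d_K|³`
(`natAbs_discr_eq_pow_three_of_discr_eq_discr`).

This is the half "cubic field of discriminant `D` ↦ unramified cyclic cubic extension of `ℚ(√D)`"
of Hasse's class-field-theoretic description of cubic fields (H. Hasse, *Arithmetische Theorie der
kubischen Zahlkörper auf klassenkörpertheoretischer Grundlage*, Math. Z. 31 (1930) 565–582: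
`d(K₃) = d(K₂) f²` with `f` the conductor of `K₃K₂/K₂`, so `d(K₃) = d(K₂)` iff `f = 1`), used by
Davenport–Heilbronn (Proc. Roy. Soc. A 322 (1971) §6) and Bhargava–Shankar–Tsimerman
(arXiv:1005.0672 §8.1: "a nowhere totally ramified cubic field … `K₆/K₂` is unramified") to count
cubic fields of fundamental discriminant by the `3`-torsion of `Cl(ℚ(√D))`.

## Proof (inertia groups in `Gal(L/ℚ)`, of order `6`)

Let `Q ⊆ 𝓞 L` be maximal, `I = I(Q) ≤ G = Gal(L/ℚ)`, `H_K = Gal(L/K)` (order `3`),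
`H_F = Gal(L/F)` (order `2`), and suppose `L/K` ramifies at `Q`, i.e. `H_K ≤ I`.
* `ramificationIdx_under_eq_three`: then the prime `Q ∩ F` of `F` is totally ramified,
  `e(Q ∩ F | p) = 3` (`#I = e(Q ∩ F|p) · #(I ∩ H_F)` with `#I ∈ {3, 6}`).
* `pow_ramificationIdx_sub_one_dvd_discr`: so `p² ∣ d_F` (`(Q ∩ F)^{e-1} ∣ 𝔇_{F/ℤ}`, Mathlib
  `pow_sub_one_dvd_differentIdeal`, and `N(𝔇_{F/ℤ}) = |d_F|`).
* `natAbs_eq_two_of_sq_dvd_of_isFundamental`: `p² ∣ d_F = d_K` fundamental forces `p = 2` and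
  `2 ∣ d_K`, so `2` ramifies in `K` (Dedekind, Mathlib `not_dvd_discr_iff_isUnramifiedIn`; all primes
  of the Galois field `K` over `2` have the same index), whence `#I = e(Q ∩ K|2) · 3 = 6`: `I = G`.
* `isMulCommutative_of_inertia_eq_top`: but a group of order `6` which is the inertia group at a
  prime over `2` is abelian: `G₁` is a normal `2`-subgroup (Serre IV §2 Cor. 3, tree
  `Ideal.isPGroup_ramificationSubgroup_one`; normal as `D(Q) = G`), of order `≤ 2`, hence central,
  and `G/G₁ = G₀/G₁` is cyclic (Serre IV §2 Cor. 1, tree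
  `exists_inertia_eq_ramificationSubgroup_one_mul_zpowers`).
* An abelian `Gal(L/ℚ)` would make `F/ℚ` Galois, contradicting `d_F = d_K · 1²`
  (`not_isGalois_of_discr_eq_mul_sq`).

## References

* H. Hasse, Math. Z. 31 (1930) 565–582, §1 (`d(K₃) = d(K₂) f²`). [Hasse1930]
* H. Davenport, H. Heilbronn, Proc. Roy. Soc. London A 322 (1971) 405–420, §6. [DavenportHeilbronn1971]
* M. Bhargava, A. Shankar, J. Tsimerman, Invent. Math. 193 (2013) = arXiv:1005.0672, §8.1.
  [BhargavaShankarTsimerman2012]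
* J.-P. Serre, *Local Fields*, GTM 67 (1979), Ch. IV §2, Cor. 1 and Cor. 3 of Prop. 7.
  [SerreLocalFields1979]
-/

noncomputable section

-- the `Algebra ℚ ↥K` diamond (`IntermediateField.algebra` vs `DivisionRing.toRatAlgebra`) is only
-- defeq at default transparency (as in `UnramifiedCubicResolventDiscriminant.lean`).
set_option backward.isDefEq.respectTransparency false

open NumberField Ideal Module IntermediateField
open scoped Pointwise

namespace Literature.NumberTheory.CubicFields

open Literature.NumberTheory.NumberFields Literature.NumberTheory.QuadraticFields
  Literature.NumberTheory.GaloisRepresentations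

/-! ### Two group-theoretic preliminaries -/

/-- A normal subgroup of order `2` is central (its non-trivial element is alone in its conjugacy
class). [folklore] -/
theorem le_center_of_card_eq_two {G : Type*} [Group G] (N : Subgroup G) [hN : N.Normal]
    (h2 : Nat.card N = 2) : N ≤ Subgroup.center G := by
  intro n hn
  rw [Subgroup.mem_center_iff]
  intro g
  by_cases hn1 : n = 1
  · rw [hn1, mul_one, one_mul]
  have hc : g * n * g⁻¹ ∈ N := hN.conj_mem n hn g
  -- `N` has exactly one element different from `1`
  obtain ⟨y, -, hy⟩ := (Nat.card_eq_two_iff' (1 : N)).mp h2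
  have h1 : (⟨n, hn⟩ : N) = y := hy ⟨n, hn⟩ (fun h => hn1 (congrArg Subtype.val h))
  have h2' : (⟨g * n * g⁻¹, hc⟩ : N) = y := by
    refine hy ⟨g * n * g⁻¹, hc⟩ fun h => hn1 ?_
    have h' : g * n * g⁻¹ = 1 := congrArg Subtype.val h
    rw [mul_inv_eq_one, mul_eq_left] at h'
    exact h'
  have h3 : g * n * g⁻¹ = n := congrArg Subtype.val (h2'.trans h1.symm)
  calc g * n = g * n * g⁻¹ * g := by rw [inv_mul_cancel_right]
    _ = n * g := by rw [h3]

/-- A `2`-power dividing `6` is `1` or `2`. [folklore] -/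
theorem eq_one_or_eq_two_of_two_pow_dvd_six {n m : ℕ} (hm : m = 2 ^ n) (h6 : m ∣ 6) :
    m = 1 ∨ m = 2 := by
  subst hm
  rcases n with _ | _ | n
  · exact Or.inl rfl
  · exact Or.inr rfl
  · exfalso
    have h4 : 4 ∣ 2 ^ (n + 2) := ⟨2 ^ n, by ring⟩
    have := h4.trans h6
    omega

/-! ### An inertia group of order `6` at a prime over `2` is abelian -/

section Inertia

variable {L : Type*} [Field L] [NumberField L] [IsGalois ℚ L]

/-- **A Galois group of order `6` which is the full inertia group at a prime above `2` is
abelian.**  With `G = Gal(L/ℚ)` of order `6`, `Q ∋ 2` maximal and `I(Q) = G` (so `D(Q) = G`): the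
wild inertia `G₁` is a `2`-group (Serre IV §2 Cor. 3) normal in `D(Q) = G`, of order `1` or `2`,
hence central; and `G₀/G₁ = G/G₁` is cyclic (Serre IV §2 Cor. 1); a group with cyclic central
quotient is abelian. [cite: SerreLocalFields1979, Ch. IV §2 Cor. 1 and Cor. 3 of Prop. 7] -/
theorem isMulCommutative_of_inertia_eq_top (h6 : Nat.card (L ≃ₐ[ℚ] L) = 6) (Q : Ideal (𝓞 L))
    [Q.IsMaximal] (h2 : (2 : 𝓞 L) ∈ Q) (hI : Q.inertia (L ≃ₐ[ℚ] L) = ⊤) :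
    IsMulCommutative (L ≃ₐ[ℚ] L) := by
  classical
  haveI hGal : IsGaloisGroup (L ≃ₐ[ℚ] L) ℤ (𝓞 L) := inferInstance
  haveI : FaithfulSMul (L ≃ₐ[ℚ] L) (𝓞 L) := hGal.faithful
  have hQne : Q ≠ ⊥ := Ideal.IsMaximal.ne_bot_of_isIntegral_int Q
  have hQtop : Q ≠ ⊤ := Ideal.IsMaximal.ne_top inferInstance
  haveI : Finite (𝓞 L ⧸ Q) := Ideal.finiteQuotientOfFreeOfNeBot Q hQne
  haveI : Fact (Nat.Prime 2) := ⟨Nat.prime_two⟩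
  set G₁ : Subgroup (L ≃ₐ[ℚ] L) := Q.ramificationSubgroup (L ≃ₐ[ℚ] L) 1 with hG₁
  -- `G₁` is a `2`-group of order dividing `6`: order `1` or `2`
  have hP : IsPGroup 2 G₁ :=
    Q.isPGroup_ramificationSubgroup_one (L ≃ₐ[ℚ] L) hQtop (p := 2) (by exact_mod_cast h2)
  obtain ⟨n, hn⟩ := hP.exists_card_eq
  have hcard : Nat.card G₁ = 1 ∨ Nat.card G₁ = 2 :=
    eq_one_or_eq_two_of_two_pow_dvd_six hn (h6 ▸ Subgroup.card_subgroup_dvd_card G₁)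
  -- the decomposition group is everything, so `G₁` is normal
  have hD : ∀ g : L ≃ₐ[ℚ] L, g ∈ Q.decompositionSubgroup (L ≃ₐ[ℚ] L) := by
    intro g
    rw [Ideal.mem_decompositionSubgroup_iff]
    have hg : g ∈ Q.inertia (L ≃ₐ[ℚ] L) := by rw [hI]; exact Subgroup.mem_top g
    exact Ideal.inertia_le_stabilizer Q hg
  haveI hN : G₁.Normal := ⟨fun σ hσ g => Q.ramificationSubgroup_conj_mem (L ≃ₐ[ℚ] L) hσ (hD g)⟩
  -- `G₁` is central
  have hcen : G₁ ≤ Subgroup.center (L ≃ₐ[ℚ] L) := by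
    rcases hcard with h1 | h2'
    · rw [Subgroup.eq_bot_of_card_eq G₁ h1]
      exact bot_le
    · exact le_center_of_card_eq_two G₁ h2'
  -- `G/G₁` is cyclic: `G = G₀ = G₁ · ⟨s⟩`
  obtain ⟨s, -, hs⟩ := exists_inertia_eq_ramificationSubgroup_one_mul_zpowers Q (L ≃ₐ[ℚ] L) hQne
  haveI : IsCyclic ((L ≃ₐ[ℚ] L) ⧸ G₁) := by
    refine isCyclic_iff_exists_zpowers_eq_top.mpr ⟨QuotientGroup.mk' G₁ s, ?_⟩
    rw [eq_top_iff]
    rintro x -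
    obtain ⟨g, rfl⟩ := QuotientGroup.mk'_surjective G₁ x
    obtain ⟨k, hk⟩ := hs g (by rw [hI]; exact Subgroup.mem_top g)
    have hz : (s ^ k)⁻¹ * g ∈ G₁ := by
      have := hN.conj_mem _ hk (s ^ k)⁻¹
      simpa only [inv_inv, mul_assoc, inv_mul_cancel, mul_one] using this
    refine Subgroup.mem_zpowers_iff.mpr ⟨k, ?_⟩
    rw [← map_zpow, QuotientGroup.mk'_eq_mk']
    exact ⟨(s ^ k)⁻¹ * g, hz, by rw [mul_inv_cancel_left]⟩
  exact MonoidHom.isMulCommutative_of_isCyclic_of_ker_le_center (QuotientGroup.mk' G₁)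
    (by rw [QuotientGroup.ker_mk']; exact hcen)

end Inertia

/-! ### Total ramification in the cubic subfield and the discriminant -/

/-- **`p^{e-1} ∣ d_F` for a prime `P ∣ p` of `F` of ramification index `e`**: `P^{e-1}` divides
the different `𝔇_{F/ℤ}` (Mathlib `pow_sub_one_dvd_differentIdeal`), whose norm is `|d_F|`
(`NumberField.absNorm_differentIdeal`), and `p ∣ N(P)`. [folklore] -/
theorem pow_ramificationIdx_sub_one_dvd_discr (F : Type*) [Field F] [NumberField F]
    (P : Ideal (𝓞 F)) [P.IsMaximal] {p : ℤ} (hp : P.under ℤ = Ideal.span {p}) :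
    p ^ (P.ramificationIdx ℤ - 1) ∣ discr F := by
  classical
  have hPbot : P ≠ ⊥ := Ideal.IsMaximal.ne_bot_of_isIntegral_int P
  have hpbot : P.under ℤ ≠ ⊥ := under_ne_bot ℤ hPbot
  haveI : (P.under ℤ).IsMaximal := IsMaximal.under ℤ P
  -- separability of the fraction fields (for `pow_sub_one_dvd_differentIdeal`)
  letI : Algebra (FractionRing ℤ) (FractionRing (𝓞 F)) := FractionRing.liftAlgebra _ _
  haveI : Algebra.IsSeparable (FractionRing ℤ) (FractionRing (𝓞 F)) := by
    refine Algebra.IsSeparable.of_equiv_equiv (FractionRing.algEquiv ℤ ℚ).symm.toRingEquiv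
      (FractionRing.algEquiv (𝓞 F) F).symm.toRingEquiv ?_
    ext x
    exact IsFractionRing.algEquiv_commutes (FractionRing.algEquiv ℤ ℚ).symm
      (FractionRing.algEquiv (𝓞 F) F).symm _
  -- `P^e ∣ p 𝓞_F`, so `P^{e-1} ∣ 𝔇`
  have hPe : P ^ P.ramificationIdx ℤ ∣ (P.under ℤ).map (algebraMap ℤ (𝓞 F)) := by
    rw [← ramificationIdx'_eq_ramificationIdx (P.under ℤ) P hpbot, dvd_iff_le]
    exact le_pow_ramificationIdx'
  have hdiff : P ^ (P.ramificationIdx ℤ - 1) ∣ differentIdeal ℤ (𝓞 F) :=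
    pow_sub_one_dvd_differentIdeal ℤ P _ hpbot hPe
  -- norms
  have hN : (Ideal.absNorm P : ℤ) ^ (P.ramificationIdx ℤ - 1) ∣ ((discr F).natAbs : ℤ) := by
    have h := map_dvd Ideal.absNorm hdiff
    rw [map_pow, absNorm_differentIdeal F (𝓞 F)] at h
    exact_mod_cast h
  have hpN : p ∣ (Ideal.absNorm P : ℤ) := by
    have hmem : ((Ideal.absNorm P : ℤ) : 𝓞 F) ∈ P := by exact_mod_cast Ideal.absNorm_mem P
    have hmem' : (Ideal.absNorm P : ℤ) ∈ P.under ℤ := by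
      rw [Ideal.under_def, Ideal.mem_comap, map_natCast]
      exact_mod_cast hmem
    rw [hp, Ideal.mem_span_singleton] at hmem'
    exact hmem'
  exact Int.dvd_natAbs.mp ((pow_dvd_pow_of_dvd hpN _).trans hN)

/-- **`p² ∣ D` with `D` a fundamental discriminant forces `|p| = 2`** (the odd part of a
fundamental discriminant is squarefree). [folklore] -/
theorem natAbs_eq_two_of_sq_dvd_of_isFundamental {D p : ℤ} (hp : Prime p)
    (hD : (D % 4 = 1 ∧ Squarefree D ∧ D ≠ 1) ∨
      (4 ∣ D ∧ (D / 4 % 4 = 2 ∨ D / 4 % 4 = 3) ∧ Squarefree (D / 4)))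
    (hdvd : p ^ 2 ∣ D) : p.natAbs = 2 := by
  rcases hD with ⟨-, hsq, -⟩ | ⟨h4, -, hsq⟩
  · exact absurd (hsq p (by rwa [← sq])) hp.not_unit
  · obtain ⟨m, rfl⟩ := h4
    rw [Int.mul_ediv_cancel_left _ (by norm_num : (4 : ℤ) ≠ 0)] at hsq
    by_contra hne
    -- `p` is an odd prime, so `p²` is prime to `4` and divides `m`
    have hp2 : ¬ p ∣ 2 := by
      intro h
      have h' : p.natAbs ∣ 2 := by
        have := Int.natAbs_dvd_natAbs.mpr h
        simpa using this
      have hpn : p.natAbs.Prime := Int.prime_iff_natAbs_prime.mp hp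
      rcases (Nat.dvd_prime Nat.prime_two).mp h' with h1 | h2
      · exact hpn.one_lt.ne' h1
      · exact hne h2
    have hcop : IsCoprime p 2 := (Irreducible.coprime_iff_not_dvd hp.irreducible).mpr hp2
    have hcop4 : IsCoprime (p ^ 2) (4 : ℤ) := by
      rw [show (4 : ℤ) = 2 ^ 2 by norm_num]
      exact IsCoprime.pow hcop
    have hm : p ^ 2 ∣ m := hcop4.dvd_of_dvd_mul_left hdvd
    exact hp.not_unit (hsq p (by rwa [← sq]))

/-! ### The main theorem -/

section Main

variable {L : Type*} [Field L] [NumberField L] [IsGalois ℚ L]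

/-- **Total ramification in the cubic subfield.**  Let `L/ℚ` be a Galois sextic, `K ⊆ L` quadratic,
`F ⊆ L` cubic, and `Q ⊆ 𝓞 L` a maximal ideal at which `L/K` ramifies (`Gal(L/K) ≤ I(Q)`).  Then
the prime `Q ∩ F` of `F` has ramification index `3` over `ℤ`: `#I(Q) = e(Q ∩ F | ℤ) · #(I(Q) ∩ Gal(L/F))`
with `#I(Q) ∈ {3, 6}` and `#Gal(L/F) = 2`. [folklore] -/
theorem ramificationIdx_under_eq_three (hL : finrank ℚ L = 6) (K F : IntermediateField ℚ L)
    (hK : finrank ℚ K = 2) (hF : finrank ℚ F = 3) (Q : Ideal (𝓞 L)) [Q.IsMaximal]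
    (hram : K.fixingSubgroup ≤ Q.inertia (L ≃ₐ[ℚ] L)) :
    (Q.under (𝓞 F)).ramificationIdx ℤ = 3 := by
  classical
  set I : Subgroup (L ≃ₐ[ℚ] L) := Q.inertia (L ≃ₐ[ℚ] L) with hIdef
  have hG : Nat.card (L ≃ₐ[ℚ] L) = 6 := by rw [IsGalois.card_aut_eq_finrank, hL]
  have hKL : finrank K L = 3 := by
    have h := Module.finrank_mul_finrank ℚ K L
    rw [hK, hL] at h
    omega
  have hFL : finrank F L = 2 := by
    have h := Module.finrank_mul_finrank ℚ F L
    rw [hF, hL] at h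
    omega
  have hHK : Nat.card K.fixingSubgroup = 3 := by rw [IsGalois.card_fixingSubgroup_eq_finrank, hKL]
  have hHF : Nat.card F.fixingSubgroup = 2 := by rw [IsGalois.card_fixingSubgroup_eq_finrank, hFL]
  -- `#I ∈ {3, 6}`
  have h3I : 3 ∣ Nat.card I := hHK ▸ Subgroup.card_dvd_of_le hram
  have hI6 : Nat.card I ∣ 6 := hG ▸ Subgroup.card_subgroup_dvd_card I
  have hIpos : 0 < Nat.card I := Nat.card_pos
  have hI36 : Nat.card I = 3 ∨ Nat.card I = 6 := by
    have hle : Nat.card I ≤ 6 := Nat.le_of_dvd (by norm_num) hI6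
    interval_cases h : Nat.card I <;> omega
  -- `#I = e(Q ∩ F | ℤ) · #(I ⊓ H_F)`
  haveI : IsGaloisGroup F.fixingSubgroup F L := IsGaloisGroup.intermediateField (L ≃ₐ[ℚ] L) ℚ L F
  haveI : (Q.under (𝓞 F)).IsMaximal := Ideal.IsMaximal.under (𝓞 F) Q
  have htower := ramificationIdx_tower (R := ℤ) (Q.under (𝓞 F)) Q
  rw [← card_inertia_eq_ramificationIdx_int L (L ≃ₐ[ℚ] L) Q,
    ← card_inertia_eq_ramificationIdx L F.fixingSubgroup F Q,
    card_inertia_eq_card_inf_range L Q F.fixingSubgroup.subtype F.fixingSubgroup.subtype_injective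
      (fun _ _ => rfl), Subgroup.range_subtype] at htower
  change Nat.card I = (Q.under (𝓞 F)).ramificationIdx ℤ *
    Nat.card (I ⊓ F.fixingSubgroup : Subgroup (L ≃ₐ[ℚ] L)) at htower
  have hinf2 : Nat.card (I ⊓ F.fixingSubgroup : Subgroup (L ≃ₐ[ℚ] L)) ∣ 2 :=
    hHF ▸ Subgroup.card_dvd_of_le inf_le_right
  have hinfI : Nat.card (I ⊓ F.fixingSubgroup : Subgroup (L ≃ₐ[ℚ] L)) ∣ Nat.card I :=
    Subgroup.card_dvd_of_le inf_le_left
  rcases hI36 with h3 | h6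
  · -- `#(I ⊓ H_F) ∣ gcd(3, 2) = 1`
    rw [h3] at hinfI htower
    have h1 : Nat.card (I ⊓ F.fixingSubgroup : Subgroup (L ≃ₐ[ℚ] L)) = 1 := by
      have := Nat.dvd_gcd hinfI hinf2
      simpa using this
    rw [h1, mul_one] at htower
    exact htower.symm
  · -- `I = G`, `I ⊓ H_F = H_F` has order `2`
    have hItop : I = ⊤ := Subgroup.eq_top_of_card_eq I (by rw [h6, hG])
    rw [hItop, top_inf_eq, hHF, Subgroup.card_top, hG] at htower
    omega

/-- **`2 ∣ d_K` forces every prime of the Galois field `K` over `2` to be ramified** — more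
generally for any rational prime `p ∣ d_K`: by Dedekind (Mathlib `not_dvd_discr_iff_isUnramifiedIn`)
some prime over `p` ramifies, and in a Galois extension all primes over `p` have the same
ramification index. [folklore] -/
theorem ramificationIdx_ne_one_of_dvd_discr {K : Type*} [Field K] [NumberField K] [IsGalois ℚ K]
    {p : ℤ} (hp : Prime p) (hdvd : p ∣ discr K) (v : Ideal (𝓞 K)) [v.IsMaximal]
    [hv : v.LiesOver (Ideal.span {p})] : v.ramificationIdx ℤ ≠ 1 := by
  intro h1
  have hunr : Algebra.IsUnramifiedIn (𝓞 K) (Ideal.span {p}) := by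
    rw [Algebra.isUnramifiedIn_iff_forall_of_isDedekindDomain]
    intro P hP hPover
    haveI := hP
    haveI := hPover
    rw [← Ideal.ramificationIdx_eq_one_iff]
    haveI : (Ideal.span {p}).IsPrime := (Ideal.span_singleton_prime hp.ne_zero).mpr hp
    rw [← ramificationIdxIn_eq_ramificationIdx (Ideal.span {p}) P (K ≃ₐ[ℚ] K),
      ramificationIdxIn_eq_ramificationIdx (Ideal.span {p}) v (K ≃ₐ[ℚ] K), h1]
  exact (NumberField.not_dvd_discr_iff_isUnramifiedIn K (𝓞 K) hp).mpr hunr hdvd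

/-- **Hasse (1930): `d_F = d_K` forces `L/K` unramified.**  Let `L/ℚ` be a Galois number field of
degree `6`, `K ⊆ L` a quadratic and `F ⊆ L` a cubic subfield with `discr F = discr K`.  Then every
maximal ideal of `𝓞 L` is unramified over `𝓞 K` (the conductor `f` in Hasse's `d(K₃) = d(K₂) f²`
is `1`; BST §8.1: `K₆/K₂` is unramified for a nowhere totally ramified cubic field `K₃`).  See the
module docstring for the proof via inertia groups.
[cite: Hasse1930, Math. Z. 31, §1 (d(K₃) = d(K₂) f²)] [cite: BhargavaShankarTsimerman2012, §8.1] -/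
theorem isUnramifiedAt_of_discr_eq_discr (hL : finrank ℚ L = 6) (K F : IntermediateField ℚ L)
    (hK : finrank ℚ K = 2) (hF : finrank ℚ F = 3) (hd : discr F = discr K)
    (Q : Ideal (𝓞 L)) [Q.IsMaximal] : Algebra.IsUnramifiedAt (𝓞 K) Q := by
  classical
  set I : Subgroup (L ≃ₐ[ℚ] L) := Q.inertia (L ≃ₐ[ℚ] L) with hIdef
  have hG : Nat.card (L ≃ₐ[ℚ] L) = 6 := by rw [IsGalois.card_aut_eq_finrank, hL]
  have hKL : finrank K L = 3 := by
    have h := Module.finrank_mul_finrank ℚ K L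
    rw [hK, hL] at h
    omega
  have hHK : Nat.card K.fixingSubgroup = 3 := by rw [IsGalois.card_fixingSubgroup_eq_finrank, hKL]
  haveI : IsGaloisGroup K.fixingSubgroup K L := IsGaloisGroup.intermediateField (L ≃ₐ[ℚ] L) ℚ L K
  haveI : (Q.under (𝓞 K)).IsMaximal := Ideal.IsMaximal.under (𝓞 K) Q
  -- `e(Q | 𝓞 K) = #(I ⊓ H_K)`
  have heK : Q.ramificationIdx (𝓞 K) = Nat.card (I ⊓ K.fixingSubgroup : Subgroup (L ≃ₐ[ℚ] L)) := by
    rw [← card_inertia_eq_ramificationIdx L K.fixingSubgroup K Q,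
      card_inertia_eq_card_inf_range L Q K.fixingSubgroup.subtype K.fixingSubgroup.subtype_injective
        (fun _ _ => rfl), Subgroup.range_subtype]
  by_contra hram
  rw [← Ideal.ramificationIdx_eq_one_iff, heK] at hram
  -- `I ⊓ H_K ≠ 1` has order `3`, so `H_K ≤ I`
  have hinf3 : Nat.card (I ⊓ K.fixingSubgroup : Subgroup (L ≃ₐ[ℚ] L)) ∣ 3 :=
    hHK ▸ Subgroup.card_dvd_of_le inf_le_right
  have hinf : Nat.card (I ⊓ K.fixingSubgroup : Subgroup (L ≃ₐ[ℚ] L)) = 3 := by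
    rcases (Nat.dvd_prime Nat.prime_three).mp hinf3 with h | h
    · exact absurd h hram
    · exact h
  have hHI : K.fixingSubgroup ≤ I := by
    have heq : (I ⊓ K.fixingSubgroup : Subgroup (L ≃ₐ[ℚ] L)) = K.fixingSubgroup :=
      Subgroup.eq_of_le_of_card_ge inf_le_right (by rw [hinf, hHK])
    rw [← heq]
    exact inf_le_left
  -- the prime below `Q`
  obtain ⟨p, hpgen⟩ := (Submodule.IsPrincipal.principal (Q.under ℤ) : ∃ p, Q.under ℤ = Submodule.span ℤ {p})
  change Q.under ℤ = Ideal.span {p} at hpgen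
  have hQbot : Q ≠ ⊥ := Ideal.IsMaximal.ne_bot_of_isIntegral_int Q
  have hp : Prime p := by
    have hpr : (Q.under ℤ).IsPrime := Ideal.IsPrime.under ℤ Q
    have hne : Q.under ℤ ≠ ⊥ := under_ne_bot ℤ hQbot
    rw [hpgen] at hpr hne
    have hp0 : p ≠ 0 := fun h => hne (by rw [h, Ideal.span_singleton_eq_bot.mpr rfl])
    exact (Ideal.span_singleton_prime hp0).mp hpr
  -- `e(Q ∩ F | ℤ) = 3`, so `p² ∣ d_F = d_K`, so `|p| = 2`
  haveI : (Q.under (𝓞 F)).IsMaximal := Ideal.IsMaximal.under (𝓞 F) Q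
  have he3 := ramificationIdx_under_eq_three hL K F hK hF Q hHI
  have hpF : Q.under ℤ = (Q.under (𝓞 F)).under ℤ := (Ideal.under_under Q).symm
  have hp2 : p ^ 2 ∣ discr K := by
    have h := pow_ramificationIdx_sub_one_dvd_discr F (Q.under (𝓞 F)) (p := p) (by rw [← hpF, hpgen])
    rw [he3, hd] at h
    exact h
  have hp2abs : p.natAbs = 2 :=
    natAbs_eq_two_of_sq_dvd_of_isFundamental hp (Quadratic.isFundamentalDiscriminant_discr hK) hp2
  have hspan2 : Q.under ℤ = Ideal.span {(2 : ℤ)} := by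
    rw [hpgen, Ideal.span_singleton_eq_span_singleton, Int.associated_iff_natAbs, hp2abs]
    rfl
  -- `2 ∣ d_K`: every prime of `K` over `2` is ramified, in particular `Q ∩ K`
  have h2K : (2 : ℤ) ∣ discr K := by
    have h4 : p ^ 2 ∣ discr K := hp2
    have h2p : (2 : ℤ) ∣ p := Int.natAbs_dvd_natAbs.mp (by rw [hp2abs]; norm_num)
    exact (Dvd.dvd.mul_right h2p p).trans (by rw [sq] at h4; exact h4)
  haveI : (Q.under (𝓞 K)).LiesOver (Ideal.span {(2 : ℤ)}) := by
    rw [← hspan2, ← Ideal.under_under Q (B := 𝓞 K)]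
    exact ⟨rfl⟩
  haveI : IsGalois ℚ K := by
    -- `K/ℚ` is Galois: its fixing subgroup (of index `2`) is normal
    haveI : K.fixingSubgroup.Normal := by
      refine Subgroup.normal_of_index_eq_two ?_
      have h := Subgroup.card_mul_index K.fixingSubgroup
      rw [hHK, hG] at h
      omega
    have hfix : IntermediateField.fixedField K.fixingSubgroup = K := IsGalois.fixedField_fixingSubgroup K
    haveI := IsGalois.of_fixedField_normal_subgroup (K := ℚ) (L := L) K.fixingSubgroup
    exact IsGalois.of_algEquiv (IntermediateField.equivOfEq hfix)
  have heK1 : (Q.under (𝓞 K)).ramificationIdx ℤ ≠ 1 :=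
    ramificationIdx_ne_one_of_dvd_discr Int.prime_two h2K (Q.under (𝓞 K))
  -- hence `#I = e(Q ∩ K | ℤ) · 3 = 6` and `I = G`
  have htower := ramificationIdx_tower (R := ℤ) (Q.under (𝓞 K)) Q
  rw [← card_inertia_eq_ramificationIdx_int L (L ≃ₐ[ℚ] L) Q, heK] at htower
  change Nat.card I = (Q.under (𝓞 K)).ramificationIdx ℤ *
    Nat.card (I ⊓ K.fixingSubgroup : Subgroup (L ≃ₐ[ℚ] L)) at htower
  rw [hinf] at htower
  have hI6 : Nat.card I ∣ 6 := hG ▸ Subgroup.card_subgroup_dvd_card I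
  have hItop : I = ⊤ := by
    refine Subgroup.eq_top_of_card_eq I ?_
    rw [hG]
    have hle : Nat.card I ≤ 6 := Nat.le_of_dvd (by norm_num) hI6
    have hpos : 0 < Nat.card I := Nat.card_pos
    interval_cases h : Nat.card I <;> omega
  -- so `G` is abelian …
  have h2Q : (2 : 𝓞 L) ∈ Q := by
    have : (2 : ℤ) ∈ Q.under ℤ := by rw [hspan2]; exact Ideal.mem_span_singleton_self 2
    rw [Ideal.under_def, Ideal.mem_comap] at this
    simpa using this
  haveI hcomm : IsMulCommutative (L ≃ₐ[ℚ] L) := isMulCommutative_of_inertia_eq_top hG Q h2Q hItop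
  -- … and `F/ℚ` would be Galois
  haveI : F.fixingSubgroup.Normal := Subgroup.normal_of_isMulCommutative _
  have hfixF : IntermediateField.fixedField F.fixingSubgroup = F := IsGalois.fixedField_fixingSubgroup F
  haveI := IsGalois.of_fixedField_normal_subgroup (K := ℚ) (L := L) F.fixingSubgroup
  haveI hFgal : IsGalois ℚ F := IsGalois.of_algEquiv (IntermediateField.equivOfEq hfixF)
  exact not_isGalois_of_discr_eq_mul_sq hK F hF one_ne_zero (by rw [hd, one_pow, mul_one]) hFgal

/-- **Numerical form: `|d_L| = |d_K|³`.**  Under the hypotheses of `isUnramifiedAt_of_discr_eq_discr`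
(`L/ℚ` Galois sextic, `K` quadratic, `F` cubic, `d_F = d_K`), the discriminant of `L` is `± d_K³`
(Neukirch III (2.9)–(2.10) for the unramified `L/K`). [cite: Hasse1930, Math. Z. 31, §1] -/
theorem natAbs_discr_eq_pow_three_of_discr_eq_discr (hL : finrank ℚ L = 6)
    (K F : IntermediateField ℚ L) (hK : finrank ℚ K = 2) (hF : finrank ℚ F = 3)
    (hd : discr F = discr K) : (discr L).natAbs = (discr K).natAbs ^ 3 := by
  have hKL : finrank K L = 3 := by
    have h := Module.finrank_mul_finrank ℚ K L
    rw [hK, hL] at h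
    omega
  rw [← hKL]
  exact natAbs_discr_eq_pow_of_forall_isUnramifiedAt
    (fun P _ => isUnramifiedAt_of_discr_eq_discr hL K F hK hF hd P)

end Main

end Literature.NumberTheory.CubicFields

end
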